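import Mathlib
import Summits.PneNP.PneNP.Theses.ClusUniversalCertificate
import Summits.PneNP.PneNP.Theorems.ClusUniversalCertificateCubeC

/-!
# Crux `UniversalCertAll` (stmt-PneNP-19683) — sketch line "flat-family inequality" (FFI; planner pnp-ideate-p1 g18; registered g19)

FRONTIER rung F-N1; nothing here bears on P vs NP.

Blocks: a point is `y : Fin n → Fin m → ZMod 2`, block `k` is `y k : Fin m → ZMod 2`, `q = 2^m`.
A POINTED FIBRE FLAT is a pair `(y, F y)` with `y ∈ F y` and `F y ⊆ V_{S(y)}` (every point of `F y` vanishes on the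
zero blocks of `y`).  Its EXCESS is `dim (F y) − (m−1)·w(y)`, `w(y)` = number of nonzero blocks of `y`.
An OWN ZERO INCIDENCE of the family is a pair `(t,k)` with `t_k = 0`, `t ∈ F y`, `y_k ≠ 0` for some payer `y`
(payer = member of positive excess).

(FFI)  Σ_{y ∈ Y} (excess y)⁺ ≤ (q − 1) · #{own zero incidences}.

Two versions (g18 paper, planner NOTES M12–M14):
* `FFIMax` — the family is the MAXIMAL fibre flats of a point set `Y` (each `F y ⊆ Y`, of maximum dimension among fibre
  flats of `y` inside `Y`).  `FFIMax` for `Y` and all its payer sub-families is exactly the Hall condition of the routing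
  statement LH_{q−1} (route every payer's excess units to own zero incidences on its flat, capacity `q−1` per incidence),
  and `FFIMax` ⟹ BLOCK-D′ (g16) ⟹ `UniversalCertAll` (chain BLOCK-D′ ⟹ UP″+ ⟹ UC, g16 lines/block-theorem-d.md; g18 M1).
  Data: 0 failures — exhaustive (2,2), 36 503 random sets at (3,2)/(2,3), the (4,2) zoo incl. W130, hyperplanes
  (tools-g18/bdown.py); implied by the cell's LH_G census (g10, ≈10⁵ instance·gauges).
* `FFI` — ARBITRARY pointed fibre flats (no ambient set).  FALSE at `m = 1` (payers 11, 10, 01 ⊆ 𝔽₂² with the lines through 00: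
  3 > 2; tools-g18/ffi.py finds thousands) but no failure at `m ≥ 2` ((2,2),(3,2),(2,3) random + hill-climb, worst slack 0;
  kit j329069: climbs (4,2) 37 854 restarts best slack 0, (2,4) −4, (3,3) −2, random (4,2) 9.9·10⁶ families worst −1 — no failure); tight on all product families.  At `m ≥ 2` a payer flat is FAT (dim ≥ (m−1)w+1 forces
  ≥ 2^{(m−1)(w−1)} own incidences, zero-reach lemma), which is what fails at `m = 1`.  Minimal counterexamples to `FFI` are
  q-CORES: every own incidence is covered by ≥ q payers (else shrink its r ≤ q−1 coverers by hyperplanes through their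
  points avoiding it: LHS −r, RHS −(q−1)).  Filed as the bold form `FFIge2All`; the skeleton below uses only `FFIMaxGe2All` (FFIMax at every shape with `m ≥ 2`).
-/

set_option linter.dupNamespace false

namespace Summit.PneNP.PneNP.Cruxes.UniversalCertAll.FlatFamily

open Classical Finset

/-- points of `(𝔽₂^m)^n`, as in the crux. -/
abbrev Pt (n m : ℕ) := Fin n → Fin m → ZMod 2

/-- number of nonzero blocks of `y`. -/
noncomputable def wt {n m : ℕ} (y : Pt n m) : ℕ := (univ.filter fun k : Fin n => y k ≠ 0).card

/-- excess of the pointed flat `(y, A)`: `dim A − (m−1)·w(y)` (an integer, may be negative). -/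
noncomputable def excess {n m : ℕ} (y : Pt n m) (A : AffineSubspace (ZMod 2) (Pt n m)) : ℤ :=
  (Module.finrank (ZMod 2) A.direction : ℤ) - ((m : ℤ) - 1) * (wt y : ℤ)

/-- `(y, F y)` is a pointed fibre flat for every `y ∈ Y`: `y ∈ F y` and `F y` vanishes on the zero blocks of `y`. -/
def IsFibreFamily {n m : ℕ} (Y : Finset (Pt n m)) (F : Pt n m → AffineSubspace (ZMod 2) (Pt n m)) : Prop :=
  ∀ y ∈ Y, y ∈ F y ∧ ∀ z ∈ F y, ∀ k : Fin n, y k = 0 → z k = 0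

/-- the own zero incidences of the family: `(t,k)` with `t_k = 0`, `t` on the flat of some PAYER `y` with `y_k ≠ 0`. -/
noncomputable def ownInc {n m : ℕ} (Y : Finset (Pt n m)) (F : Pt n m → AffineSubspace (ZMod 2) (Pt n m)) :
    Finset (Pt n m × Fin n) :=
  univ.filter fun p => p.1 p.2 = 0 ∧ ∃ y ∈ Y, 0 < excess y (F y) ∧ y p.2 ≠ 0 ∧ p.1 ∈ F y

/-- (FFI) the flat-family inequality at block shape `(n,m)`, ARBITRARY pointed fibre flats (false at `m = 1`). -/
def FFI (n m : ℕ) : Prop :=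
  ∀ (Y : Finset (Pt n m)) (F : Pt n m → AffineSubspace (ZMod 2) (Pt n m)), IsFibreFamily Y F →
    ∑ y ∈ Y, max (excess y (F y)) 0 ≤ ((2 : ℤ) ^ m - 1) * ((ownInc Y F).card : ℤ)

/-- the bold form: FFI for every block shape with `m ≥ 2`. -/
def FFIge2All : Prop := ∀ n m : ℕ, 2 ≤ m → FFI n m

/-- `F y` is a MAXIMAL fibre flat of `y` inside the point set `Y`, for every `y ∈ Y`. -/
def IsMaxFibreFamily {n m : ℕ} (Y : Finset (Pt n m)) (F : Pt n m → AffineSubspace (ZMod 2) (Pt n m)) : Prop :=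
  ∀ y ∈ Y, y ∈ F y ∧ (∀ z ∈ F y, z ∈ Y ∧ ∀ k : Fin n, y k = 0 → z k = 0) ∧
    ∀ A : AffineSubspace (ZMod 2) (Pt n m), y ∈ A → (∀ z ∈ A, z ∈ Y ∧ ∀ k : Fin n, y k = 0 → z k = 0) →
      Module.finrank (ZMod 2) A.direction ≤ Module.finrank (ZMod 2) (F y).direction

/-- (FFIMax = BD-own) the flat-family inequality for the maximal fibre flats of a point set: `Σ_y δ(y)⁺ ≤ (q−1)·#own incidences`. -/
def FFIMax (n m : ℕ) : Prop :=
  ∀ (Y : Finset (Pt n m)) (F : Pt n m → AffineSubspace (ZMod 2) (Pt n m)), IsMaxFibreFamily Y F →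
    ∑ y ∈ Y, max (excess y (F y)) 0 ≤ ((2 : ℤ) ^ m - 1) * ((ownInc Y F).card : ℤ)

/-- FFIMax for all FAT block shapes `m ≥ 2`.  (At `m = 1` the ∀-choice form is FALSE: `Y = 𝔽₂⁴ ∖ {0100,0010,0001,0111,1111}`
(coordinates LSB-first) has `Σ δ = 13` but only `10` own incidences for the first-found maximal flats — tools-g18, g18 NOTES M16;
`m = 1` of the crux is the in-tree theorem `ClusUniversalCertificate.universalCert_one` and needs no flat-family inequality.) -/
def FFIMaxGe2All : Prop := ∀ n m : ℕ, 2 ≤ m → FFIMax n m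

/-- a maximal fibre family is a fibre family, so the bold form gives the filed form at `m ≥ 2`. -/
theorem ffiMax_of_ffi {n m : ℕ} (h : FFI n m) : FFIMax n m := by
  intro Y F hF
  exact h Y F (fun y hy => ⟨(hF y hy).1, fun z hz k hk => ((hF y hy).2.1 z hz).2 k hk⟩)

theorem ffiMaxGe2All_of_ffige2All (h : FFIge2All) : FFIMaxGe2All := fun n m hm => ffiMax_of_ffi (h n m hm)

/-! ## Stubs -/

/-- [stub, TRUE on paper — the transfer at FAT block shapes `m ≥ 2`, size M/L] FFI at the maximal fibre flats of `Y` gives BLOCK-D′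
`Σ_y δ(y)⁺ ≤ (2^m−1)·Σ_k Z_k(Y)` (own incidences ⊆ all zero incidences of `Y`), and BLOCK-D′ ⟹ UC by the dimension chain
`dim D_y ≤ m·z(y) + dim(D_y ∩ V_{S(y)}) ≤ m·z(y) + (m−1)w(y) + δ(y)` summed over `y` (g18 NOTES M1; g16 lines/block-theorem-d.md).
Conclusion = the tree's per-shape form `ClusCube.Block.UniversalCert n m` (verbatim the crux's body at `(n, m)`); the shapes `m = 0, 1`
are discharged in the composition below (`universalCert_zero`, in-tree `ClusCube.universalCert_one`). -/
theorem stub_ffimax_uc : ∀ n m : ℕ, 2 ≤ m → FFIMax n m →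
    Summit.PneNP.PneNP.Theorems.ClusCube.Block.UniversalCert n m := by
  sorry

/-- [stub, OPEN — the conjecture (= Hall condition P = all payers of LH_{q−1}, fat blocks); implied by the bold `FFIge2All`.
Evidence: exhaustive (2,2) (all 65 535 Y, and all 256 incidence sets C in C-FORM), C-FORM exhaustive (2,3) (65 536 C, kit j329092),
random (3,2) 19 938 / (2,3) 16 565 sets, (4,2) 9.9·10⁶ random families + climbs (kit j329069), zoo incl. W130/W394/EB40/hyperplanes: worst slack 0. -/
theorem stub_ffimax : FFIMaxGe2All := by
  sorry

/-! ## The shapes `m = 0`, `m = 1` and the composition (kernel-checked) -/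

/-- `m = 0`: the block space `(𝔽₂⁰)ⁿ` is a single point, every block of it is `0`; both sides equal `n·|Y|`. -/
theorem universalCert_zero (n : ℕ) : Summit.PneNP.PneNP.Theorems.ClusCube.Block.UniversalCert n 0 := by
  intro Y
  have hz : ∀ (y : Summit.PneNP.PneNP.Theorems.ClusCube.Block.U n 0) (k : Fin n), y k = 0 :=
    fun y k => Subsingleton.elim _ _
  have hcod : ∀ y ∈ Y, Summit.PneNP.PneNP.Theorems.ClusCube.Block.codimIn Y y = 0 := by
    intro y hy
    apply Nat.eq_zero_of_le_zero
    apply Nat.sInf_le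
    refine ⟨⊤, AffineSubspace.mem_top _ _ _, fun z _ => ?_, by simp⟩
    rw [Subsingleton.elim z y]; exact hy
  have hL : ∑ y ∈ Y, ((n : ℤ) - (Summit.PneNP.PneNP.Theorems.ClusCube.Block.codimIn Y y : ℤ)) = ∑ _y ∈ Y, (n : ℤ) :=
    Finset.sum_congr rfl fun y hy => by rw [hcod y hy]; simp
  have hR : ∀ k : Fin n, (Y.filter fun y => y k = 0) = Y := fun k => Finset.filter_true_of_mem fun y _ => hz y k
  rw [hL]
  simp only [hR, pow_zero, one_mul, Finset.sum_const, Finset.card_univ, Fintype.card_fin, nsmul_eq_mul]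
  rw [mul_comm]

/-- the composition with the stub statements as hypotheses, per shape: `m = 0` trivial, `m = 1` the in-tree hypercube theorem
`ClusCube.universalCert_one`, `m ≥ 2` the transfer applied to the flat-family inequality. -/
theorem universalCert_from
    (h₁ : ∀ n m : ℕ, 2 ≤ m → FFIMax n m → Summit.PneNP.PneNP.Theorems.ClusCube.Block.UniversalCert n m)
    (h₂ : FFIMaxGe2All) (n m : ℕ) : Summit.PneNP.PneNP.Theorems.ClusCube.Block.UniversalCert n m := by
  rcases Nat.lt_or_ge m 2 with hm | hm
  · interval_cases m
    · exact universalCert_zero n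
    · exact Summit.PneNP.PneNP.Theorems.ClusCube.universalCert_one n
  · exact h₁ n m hm (h₂ n m hm)

/-- **The skeleton's concluding theorem**: the two registered stubs give the crux BY NAME (the only theorem of this file whose
result type is the crux decl; sorry-free as soon as the stubs are). -/
theorem UniversalCertAll_of : Summit.PneNP.PneNP.Theses.ClusUniversalCertificate.UniversalCertAll :=
  fun n m Y => universalCert_from stub_ffimax_uc stub_ffimax n m Y

/-! ## First rungs (statements; proofs by hand are routine, `decide` is too slow at these sizes) -/

/-- FFI at `n = 1`, any `m`: a pointed fibre flat `(y, A)` with `y ≠ 0` has excess `dim A − (m−1) ≤ 1`, with equality iff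
`A = ⊤`, and then `(0, 0)` is an own incidence; so LHS ≤ #payers ≤ 2^m − 1 ≤ RHS. -/
def FFIOne : Prop := ∀ m : ℕ, FFI 1 m

end Summit.PneNP.PneNP.Cruxes.UniversalCertAll.FlatFamily
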